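import Literature.Topology.FourManifolds.RoundSolidTorus
import Literature.Topology.FourManifolds.ThickenedHandlebodyFour
import Mathlib.Analysis.Complex.ExponentialBounds
import HarnessLib

/-!
# A model compact connected orientable `4`-dimensional `(1,1)`-handlebody in `ℝ⁴` whose
# boundary is an explicit `S² × S¹`

Topic `Literature/Topology/FourManifolds`; first of two files discharging the named fact (B)
`Literature.Topology.FourManifolds.nonempty_diffeomorph_boundary_sphereTwo_prod_of_handleCount_one_one`
of `PropertyRTraceClosing.lean` (the boundary of a compact connected orientable `(1,1)`-handlebody
is `S² × S¹`; Kirby, *The topology of 4-manifolds* (1989), Ch. I §2, p. 8, `k = 1`; Kosinski,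
*Differential Manifolds* (1993), VI (11.4)(c)).  By UNIQ₄ (Kosinski VI (11.4)(c), the tree's
`nonempty_diffeomorph_of_hasHandleDecomposition_handleCount_one_holds`) one model with computed
boundary suffices; this file builds the model and the coordinates of its boundary level, the
sequel `OneOneHandlebodyBoundary.lean` assembles the diffeomorphism `∂Y ≅ S² × S¹` and the
discharge.  Everything here is **proved**; no named fact is introduced.

* §1 **The model** `OneOneHandlebodyModel.Y = {F ≤ 0} ⊂ ℝ⁴`, `F(x, y, z, w) = f(x, y, z) + w²`
  (`OneOneHandlebodyModel.F`), the thickening (`SolidThickening.thicken₄`,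
  `ThickenedHandlebodyFour.lean`) of the tilted Morse function `f = G · exp(k/64)`,
  `G = (x² + y² - 4)² + 16 z² - 1`, `k = x (12 - x² - y²)`, of the round solid torus
  (`RoundSolidTorusModel.fn`, `RoundSolidTorus.lean`: `{f ≤ 0} = {G ≤ 0}`, critical points
  `(±2, 0, 0)` below `0`, of indices `0` and `1`).  `F` is Morse with the lifted critical points
  and indices (`isMorse_thicken₄`, `criticalSetOfIndex_thicken₄_inter`), `0` is a regular level
  (`isRegularLevel_F`), `{F ≤ 0}` is compact (`‖p‖² ≤ 9`), connected (one critical point of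
  index `0`; Reeb's argument `RegularSublevel.connectedSpace_of_isCompact'`), orientable, and has
  a handle decomposition with one `0`-handle and one `1`-handle (`hasHandleDecomposition_Y`,
  `RegularSublevel.hasHandleDecomposition`, Milnor 1963, Thms. 3.1–3.2) — classically
  `Y ≅ S¹ × B³`.
* §2 **Coordinates on the level `{F = 0}`.**  With the half tilt `t(x, y) = exp(k/128)`
  (`tilt`, `t² = E = exp(k/64)`), the level is `{(x² + y² - 4)² + 16 z² + (w/t)² = 1}` and
  misses `{x = y = 0}` (`three_le_of_F_eq_zero`); the sphere coordinate
  `σ(p) = (x² + y² - 4, 4 z, w/t) ∈ ℝ³` (`sig`, smooth, `‖σ‖ = 1` on the level,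
  `norm_sig_eq_one`) and the parametrisation `Φ(u, θ) = (ρ θ₀, ρ θ₁, u₁/4, u₂ t(ρ θ₀, ρ θ₁))`,
  `ρ = √(4 + u₀)` (`phi`, smooth where `4 + u₀ ≠ 0`, `contDiffAt_phi`).

## References

* R. C. Kirby, *The topology of 4-manifolds*, LNM 1374 (1989), Ch. I §2, p. 8. [Kirby1989]
* A. A. Kosinski, *Differential Manifolds*, Academic Press (1993), VI (11.4)(c). [Kosinski1993]
* J. Milnor, *Morse theory*, Ann. of Math. Studies 51 (1963), §2, Thms. 3.1–3.2, proof of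
  Thm. 4.1. [Milnor1963]
-/

open scoped Manifold ContDiff Topology
open Set Function Filter Metric Module

noncomputable section

namespace Literature.Topology.FourManifolds

/-- Local notation: `𝔼 n` is the model Euclidean space `EuclideanSpace ℝ (Fin n)`. -/
local notation "𝔼 " n:arg => EuclideanSpace ℝ (Fin n)

namespace OneOneHandlebodyModel

open SolidThickening RoundSolidTorusModel

/-! ### §1 The model `Y = {f(x, y, z) + w² ≤ 0} ⊂ ℝ⁴` -/

/-- The model function `F(x, y, z, w) = f(x, y, z) + w²`, the thickening
(`SolidThickening.thicken₄`) of the tilted Morse function `f = G · exp(k/64)` of the round solid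
torus (`RoundSolidTorusModel.fn`, `G = (x² + y² - 4)² + 16 z² - 1`). [folklore] -/
def F : 𝔼 4 → ℝ := thicken₄ fn

/-- `F` is a Morse function on `ℝ⁴` (thickening of a Morse function). [folklore] -/
theorem isMorse_F : IsMorse (𝓡 4) F := isMorse_thicken₄ isMorse_fn

/-- `F` is smooth. [folklore] -/
theorem contDiff_F : ContDiff ℝ ∞ F := contDiff_thicken₄ contDiff_fn

/-- **`0` is a regular level of `F`**: the critical points of `F` are the lifts `(u, 0)` of the
critical points `u` of `f`, where `F = f ≠ 0`. [folklore] -/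
theorem isRegularLevel_F : IsRegularLevel (𝓡 4) F 0 := by
  refine isMorse_F.isRegularLevel fun p hp => ?_
  have hd : Differentiable ℝ fn := contDiff_fn.differentiable (by simp)
  obtain ⟨u, hu, rfl⟩ := (isMCriticalPt_thicken₄_iff' hd p).1 hp
  rw [F, thicken₄_lift₃]
  exact fn_ne_zero_of_isMCriticalPt hu

/-- **The model `(1,1)`-handlebody** `Y = {F ≤ 0} = {f(x, y, z) + w² ≤ 0} ⊂ ℝ⁴`, a regular
sublevel set (`RegularSublevel`: a smooth `4`-manifold with boundary the level hypersurface
`{F = 0}`). [folklore] -/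
abbrev Y : Type := RegularSublevel isRegularLevel_F

/-- On `{G ≤ 0}` the tilt exponent satisfies `k/64 ≤ 1`. [folklore] -/
theorem kf_div_le_one {u : 𝔼 3} (hu : u 0 ^ 2 + u 1 ^ 2 + u 2 ^ 2 ≤ 6) : kf u / 64 ≤ 1 := by
  simp only [kf]
  have h0 : u 0 ^ 2 ≤ 6 := by nlinarith [sq_nonneg (u 1), sq_nonneg (u 2)]
  have h0' : |u 0| ≤ 3 := by
    rw [← Real.sqrt_sq_eq_abs]
    calc Real.sqrt (u 0 ^ 2) ≤ Real.sqrt 9 := Real.sqrt_le_sqrt (by linarith)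
      _ = 3 := by rw [show (9 : ℝ) = 3 ^ 2 by norm_num, Real.sqrt_sq (by norm_num)]
  have h1 : |12 - u 0 ^ 2 - u 1 ^ 2| ≤ 12 := by
    rw [abs_le]; constructor <;> nlinarith [sq_nonneg (u 0), sq_nonneg (u 1), sq_nonneg (u 2)]
  have : |u 0 * (12 - u 0 ^ 2 - u 1 ^ 2)| ≤ 36 := by
    rw [abs_mul]; nlinarith [abs_nonneg (u 0), abs_nonneg (12 - u 0 ^ 2 - u 1 ^ 2)]
  have := (abs_le.1 this).2
  linarith

/-- A priori bound: on `{F ≤ 0}` one has `‖p‖² ≤ 9`. [folklore] -/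
theorem norm_sq_le_of_F_le {p : 𝔼 4} (h : F p ≤ 0) : ‖p‖ ^ 2 ≤ 9 := by
  have hw : 0 ≤ p 3 ^ 2 := sq_nonneg _
  have hfn : fn (proj₃ p) ≤ 0 := by rw [F, thicken₄_apply] at h; linarith
  have h3 := norm_sq_le_of_fn_le hfn
  have hn3 : ‖proj₃ p‖ ^ 2 = (proj₃ p) 0 ^ 2 + (proj₃ p) 1 ^ 2 + (proj₃ p) 2 ^ 2 := by
    rw [EuclideanSpace.norm_sq_eq, Fin.sum_univ_three]
    simp [Real.norm_eq_abs, sq_abs]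
  -- `w² ≤ -f = -G E ≤ E ≤ e ≤ 3`
  have hG : -1 ≤ G (proj₃ p) := by
    simp only [G]; nlinarith [sq_nonneg ((proj₃ p) 0 ^ 2 + (proj₃ p) 1 ^ 2 - 4), sq_nonneg ((proj₃ p) 2)]
  have hE : E (proj₃ p) ≤ 3 := by
    have h1 : E (proj₃ p) ≤ Real.exp 1 := Real.exp_le_exp.2 (kf_div_le_one h3)
    have h2 : Real.exp 1 < 3 := lt_trans Real.exp_one_lt_d9 (by norm_num)
    linarith
  have hw3 : p 3 ^ 2 ≤ 3 := by
    rw [F, thicken₄_apply, fn] at h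
    nlinarith [E_pos (proj₃ p)]
  rw [SolidThickening.norm_sq_eq]
  linarith

/-- **`{F ≤ 0}` is compact** (closed and bounded in `ℝ⁴`). [folklore] -/
theorem isCompact_preimage_F : IsCompact (F ⁻¹' Iic (0 : ℝ)) := by
  refine Metric.isCompact_of_isClosed_isBounded (isClosed_Iic.preimage contDiff_F.continuous) ?_
  rw [isBounded_iff_forall_norm_le]
  refine ⟨3, fun p hp => ?_⟩
  have h := norm_sq_le_of_F_le (p := p) hp
  nlinarith [norm_nonneg p]

/-- `Y` is compact. [folklore] -/
instance : CompactSpace Y := RegularSublevel.compactSpace_of_isCompact _ isCompact_preimage_F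

/-- **The critical points of `F` of each index inside `{F ≤ 0}`**: the lifts of the minimum
`(2, 0, 0)` and of the saddle `(-2, 0, 0)` of `f`. [folklore] -/
theorem criticalSetOfIndex_inter (i : ℕ) :
    criticalSetOfIndex (𝓡 4) F i ∩ F ⁻¹' Iic (0 : ℝ) =
      lift₃ '' (if i = 0 then {SolidTorusModel.axisPt 2}
        else if i = 1 then {SolidTorusModel.axisPt (-2)} else ∅) := by
  rw [F, criticalSetOfIndex_thicken₄_inter (contDiff_fn.of_le (by norm_cast)),
    RoundSolidTorusModel.criticalSetOfIndex_inter]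

/-- `Y` is connected (one critical point of index `0` in `Y`). [folklore] -/
instance : ConnectedSpace Y :=
  RegularSublevel.connectedSpace_of_isCompact' _ isCompact_preimage_F
    (by rw [criticalSetOfIndex_inter]; simp)
    ⟨lift₃ (SolidTorusModel.axisPt 2), by
      rw [F, thicken₄_lift₃]; exact fn_axisPt_two_neg.le⟩

/-- `Y` is orientable (a codimension-`0` submanifold of `ℝ⁴`). [folklore] -/
theorem isOrientable_Y : IsOrientable (𝓡∂ 4) Y :=
  RegularSublevel.isOrientable _ (isOrientable_euclideanSpace 4)

/-- The handle count of `Y`: one `0`-handle, one `1`-handle, nothing else. [folklore] -/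
theorem ncard_criticalSetOfIndex_inter (i : ℕ) :
    (criticalSetOfIndex (𝓡 4) F i ∩ F ⁻¹' Iic (0 : ℝ)).ncard = handleCount 1 1 i := by
  rw [F, criticalSetOfIndex_thicken₄_inter (contDiff_fn.of_le (by norm_cast)),
    ncard_image_of_injective _ lift₃_injective, RoundSolidTorusModel.ncard_criticalSetOfIndex_inter]

/-- **`Y` has a handle decomposition with one `0`-handle and one `1`-handle** (the adapted Morse
function `F|Y + 1`; Milnor, *Morse theory* (1963), Thms. 3.1–3.2). [cite: Milnor1963, Thms. 3.1–3.2] -/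
theorem hasHandleDecomposition_Y : HasHandleDecomposition 3 Y (handleCount 1 1) := by
  have hd := RegularSublevel.hasHandleDecomposition isMorse_F isRegularLevel_F
  have hfun : (fun i => (criticalSetOfIndex (𝓡 4) F i ∩ F ⁻¹' Iic (0 : ℝ)).ncard) =
      handleCount 1 1 := funext ncard_criticalSetOfIndex_inter
  rw [hfun] at hd
  exact hd


/-! ### §2 Coordinates on the boundary level `{F = 0}` -/

/-- The half tilt factor `t(x, y) = exp(x (12 - x² - y²) / 128)`, so that `t² = E`. [folklore] -/
def tilt (x y : ℝ) : ℝ := Real.exp (x * (12 - x ^ 2 - y ^ 2) / 128)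

/-- `t > 0`. [folklore] -/
theorem tilt_pos (x y : ℝ) : 0 < tilt x y := Real.exp_pos _

/-- `t(u₀, u₁)² = E(u)`. [folklore] -/
theorem tilt_sq (u : 𝔼 3) : tilt (u 0) (u 1) ^ 2 = E u := by
  rw [tilt, E, kf, sq, ← Real.exp_add]
  congr 1
  ring

/-- `t(x, y) · exp(-x (12 - x² - y²) / 128) = 1`. [folklore] -/
theorem tilt_mul_exp_neg (x y : ℝ) :
    tilt x y * Real.exp (-(x * (12 - x ^ 2 - y ^ 2)) / 128) = 1 := by
  rw [tilt, ← Real.exp_add, neg_div, add_neg_cancel, Real.exp_zero]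

/-- The sphere coordinate `σ(x, y, z, w) = (x² + y² - 4, 4 z, w · exp(-x (12 - x² - y²) / 128))`
of a point of `ℝ⁴`. [folklore] -/
def sig (p : 𝔼 4) : 𝔼 3 :=
  WithLp.toLp 2 ![p 0 ^ 2 + p 1 ^ 2 - 4, 4 * p 2,
    p 3 * Real.exp (-(p 0 * (12 - p 0 ^ 2 - p 1 ^ 2)) / 128)]

/-- `σ₀ = x² + y² - 4`. [folklore] -/
@[simp] theorem sig_apply_zero (p : 𝔼 4) : sig p 0 = p 0 ^ 2 + p 1 ^ 2 - 4 := rfl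

/-- `σ₁ = 4 z`. [folklore] -/
@[simp] theorem sig_apply_one (p : 𝔼 4) : sig p 1 = 4 * p 2 := rfl

/-- `σ₂ = w · exp(-x (12 - x² - y²) / 128)`. [folklore] -/
@[simp] theorem sig_apply_two (p : 𝔼 4) :
    sig p 2 = p 3 * Real.exp (-(p 0 * (12 - p 0 ^ 2 - p 1 ^ 2)) / 128) := rfl

/-- `σ` is smooth. [folklore] -/
theorem contDiff_sig : ContDiff ℝ ∞ sig := by
  unfold sig
  apply PiLp.contDiff_toLp.comp
  rw [contDiff_pi]
  intro i
  fin_cases i <;> simp <;> fun_prop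

/-- `‖σ(p)‖² = G(π p) + 1 + w² / E(π p)`. [folklore] -/
theorem norm_sig_sq (p : 𝔼 4) :
    ‖sig p‖ ^ 2 = G (proj₃ p) + 1 + p 3 ^ 2 / E (proj₃ p) := by
  rw [EuclideanSpace.norm_sq_eq, Fin.sum_univ_three]
  simp only [Real.norm_eq_abs, sq_abs, sig_apply_zero, sig_apply_one, sig_apply_two]
  have hE : E (proj₃ p) = tilt (p 0) (p 1) ^ 2 := by rw [← tilt_sq]; rfl
  have he : Real.exp (-(p 0 * (12 - p 0 ^ 2 - p 1 ^ 2)) / 128) = (tilt (p 0) (p 1))⁻¹ :=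
    (inv_eq_of_mul_eq_one_right (tilt_mul_exp_neg (p 0) (p 1))).symm
  have htp := tilt_pos (p 0) (p 1)
  rw [hE, he, G, proj₃_apply_zero, proj₃_apply_one, proj₃_apply_two]
  field_simp
  ring

/-- On the level `{F = 0}`: `w² = -G(π p) E(π p)`. [folklore] -/
theorem sq_eq_of_F_eq_zero {p : 𝔼 4} (hp : F p = 0) : p 3 ^ 2 = -(G (proj₃ p) * E (proj₃ p)) := by
  rw [F, thicken₄_apply, fn] at hp
  linarith

/-- On the level `{F = 0}`: `G(π p) ≤ 0`. [folklore] -/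
theorem G_nonpos_of_F_eq_zero {p : 𝔼 4} (hp : F p = 0) : G (proj₃ p) ≤ 0 := by
  have h := sq_eq_of_F_eq_zero hp
  nlinarith [E_pos (proj₃ p), sq_nonneg (p 3)]

/-- On the level `{F = 0}`: `3 ≤ x² + y²`. [folklore] -/
theorem three_le_of_F_eq_zero {p : 𝔼 4} (hp : F p = 0) : 3 ≤ p 0 ^ 2 + p 1 ^ 2 := by
  have h := G_nonpos_of_F_eq_zero hp
  simp only [G, proj₃_apply_zero, proj₃_apply_one, proj₃_apply_two] at h
  nlinarith [sq_nonneg (p 2), sq_nonneg (p 0 ^ 2 + p 1 ^ 2 - 4)]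

/-- **On the level `{F = 0}` the sphere coordinate is a unit vector**: `‖σ(p)‖ = 1`. [folklore] -/
theorem norm_sig_eq_one {p : 𝔼 4} (hp : F p = 0) : ‖sig p‖ = 1 := by
  have h2 : ‖sig p‖ ^ 2 = 1 := by
    rw [norm_sig_sq, sq_eq_of_F_eq_zero hp]
    have := E_pos (proj₃ p)
    field_simp
    ring
  nlinarith [norm_nonneg (sig p)]

/-- The radius `ρ(u) = √(4 + u₀)`. [folklore] -/
def rho (u : 𝔼 3) : ℝ := Real.sqrt (4 + u 0)

/-- The parametrisation `Φ(u, θ) = (ρ θ₀, ρ θ₁, u₁ / 4, u₂ t(ρ θ₀, ρ θ₁))`, `ρ = √(4 + u₀)`, of the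
level `{F = 0}` by `ℝ³ × ℝ²` (restricted below to `S² × S¹`). [folklore] -/
def phi (q : 𝔼 3 × 𝔼 2) : 𝔼 4 :=
  WithLp.toLp 2 ![rho q.1 * q.2 0, rho q.1 * q.2 1, q.1 1 / 4,
    q.1 2 * tilt (rho q.1 * q.2 0) (rho q.1 * q.2 1)]

/-- `Φ₀ = ρ θ₀`. [folklore] -/
@[simp] theorem phi_apply_zero (q : 𝔼 3 × 𝔼 2) : phi q 0 = rho q.1 * q.2 0 := rfl

/-- `Φ₁ = ρ θ₁`. [folklore] -/
@[simp] theorem phi_apply_one (q : 𝔼 3 × 𝔼 2) : phi q 1 = rho q.1 * q.2 1 := rfl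

/-- `Φ₂ = u₁ / 4`. [folklore] -/
@[simp] theorem phi_apply_two (q : 𝔼 3 × 𝔼 2) : phi q 2 = q.1 1 / 4 := rfl

/-- `Φ₃ = u₂ t(ρ θ₀, ρ θ₁)`. [folklore] -/
@[simp] theorem phi_apply_three (q : 𝔼 3 × 𝔼 2) :
    phi q 3 = q.1 2 * tilt (rho q.1 * q.2 0) (rho q.1 * q.2 1) := rfl

/-- `Φ` is smooth at every point with `4 + u₀ ≠ 0`. [folklore] -/
theorem contDiffAt_phi {q : 𝔼 3 × 𝔼 2} (hq : 4 + q.1 0 ≠ 0) : ContDiffAt ℝ ∞ phi q := by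
  have hρ : ContDiffAt ℝ ∞ (fun q : 𝔼 3 × 𝔼 2 => rho q.1) q := by
    unfold rho
    exact ContDiffAt.sqrt (by fun_prop) hq
  have h0 : ContDiffAt ℝ ∞ (fun q : 𝔼 3 × 𝔼 2 => rho q.1 * q.2 0) q := hρ.mul (by fun_prop)
  have h1 : ContDiffAt ℝ ∞ (fun q : 𝔼 3 × 𝔼 2 => rho q.1 * q.2 1) q := hρ.mul (by fun_prop)
  rw [contDiffAt_euclidean]
  intro i
  fin_cases i
  · exact h0
  · exact h1
  · change ContDiffAt ℝ ∞ (fun q : 𝔼 3 × 𝔼 2 => q.1 1 / 4) q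
    fun_prop
  · change ContDiffAt ℝ ∞
      (fun q : 𝔼 3 × 𝔼 2 => q.1 2 * tilt (rho q.1 * q.2 0) (rho q.1 * q.2 1)) q
    unfold tilt
    refine ContDiffAt.mul (by fun_prop) (ContDiffAt.exp ?_)
    exact ((h0.mul ((contDiffAt_const.sub (h0.pow 2)).sub (h1.pow 2))).div_const 128)

end OneOneHandlebodyModel

end Literature.Topology.FourManifolds
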